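import Mathlib

/-!
# Tier 7 — LINE 3 support: absolute convergence of the geometric side from the count and the decay
(`Line3/AbsSummable.lean`; t7-L1-p5, gen 1; Mathlib only)

p1's version-(ii) shadow `DominantSide` (T7SupportDominantGeometricSide, row 674) carries `abs_summable : ∀ N, Summable
fun γ => ‖orb N γ‖` as a FIELD, and t7-x1's list of open items (l. 14901 (2)) names «absolute convergence of the geometric
side for L¹ coefficients — same count + decay». It IS the same count + decay: this file proves, for weights
`orb γ = a γ * b γ` on any type `Orb`, that
  `‖a γ‖ ≤ C (1 + size γ)^{-α}` (decay), `‖b γ‖ ≤ B (1 + size γ)^{d'}` on the support `arith`, `b γ ≠ 0 → arith γ`,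
  `#{γ : arith γ ∧ size γ ≤ R} ≤ C' (1 + R)^β` (count), and `β + d' < α`
imply `Summable fun γ => ‖a γ * b γ‖` (`summable_of_count_decay`). Proof: every finite partial sum is bounded by a constant —
slice the support dyadically by `k = log₂ ⌊1 + size γ⌋₊` (so `2^k ≤ 1 + size γ ≤ 2^{k+1}`): each term of slice `k` is
`≤ C B 2^{-k(α - d')}`, the slice has `≤ C' (2^{k+2})^β = C' 4^β 2^{kβ}` terms, and `Σ_k 2^{-k(α - d' - β)} < ∞`
(`summable_of_sum_le`, `tsum_geometric_of_lt_one`). So `abs_summable` is DERIVED from the other fields of `DominantSide`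
(`abs_summable_of_fields`): one displayed field fewer on the real objects. Nothing about the real objects.
Sorry-free; axioms: propext / Classical.choice / Quot.sound. §8(d): uses an L-value-free non-vanishing device: NO.
-/

namespace Summit.Ventures.HodgeRepro2.Tier7.Line3.AbsSummable

open Finset

/-- `2 ^ log₂ ⌊R⌋₊ ≤ R` for `R ≥ 1` -/
theorem two_pow_log_floor_le {R : ℝ} (hR : 1 ≤ R) : (2 : ℝ) ^ Nat.log 2 ⌊R⌋₊ ≤ R := by
  have h0 : ⌊R⌋₊ ≠ 0 := (Nat.floor_pos.mpr hR).ne'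
  have h1 : 2 ^ Nat.log 2 ⌊R⌋₊ ≤ ⌊R⌋₊ := Nat.pow_log_le_self 2 h0
  have h2 : ((⌊R⌋₊ : ℕ) : ℝ) ≤ R := Nat.floor_le (by linarith)
  calc (2 : ℝ) ^ Nat.log 2 ⌊R⌋₊ = ((2 ^ Nat.log 2 ⌊R⌋₊ : ℕ) : ℝ) := by push_cast; ring
    _ ≤ ((⌊R⌋₊ : ℕ) : ℝ) := by exact_mod_cast h1
    _ ≤ R := h2

/-- `R ≤ 2 ^ (log₂ ⌊R⌋₊ + 1)` -/
theorem le_two_pow_log_floor_succ (R : ℝ) : R ≤ (2 : ℝ) ^ (Nat.log 2 ⌊R⌋₊ + 1) := by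
  have h1 : ⌊R⌋₊ < 2 ^ (Nat.log 2 ⌊R⌋₊ + 1) := Nat.lt_pow_succ_log_self (by norm_num) ⌊R⌋₊
  have h2 : R < (⌊R⌋₊ : ℝ) + 1 := Nat.lt_floor_add_one R
  have h3 : ((⌊R⌋₊ : ℕ) : ℝ) + 1 ≤ (2 : ℝ) ^ (Nat.log 2 ⌊R⌋₊ + 1) := by exact_mod_cast h1
  linarith

/-- **ABSOLUTE CONVERGENCE FROM COUNT AND DECAY**: weights `a γ * b γ` with polynomial decay of `a` in the size, polynomial
growth of `b` on its support, and a polynomial count of the support in the size, are absolutely summable when the decay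
exponent beats count + growth (`β + d' < α`). -/
theorem summable_of_count_decay {Orb : Type} (a b : Orb → ℂ) (size : Orb → ℝ) (hsize : ∀ γ, 0 ≤ size γ)
    (arith : Orb → Prop) (hb : ∀ γ, b γ ≠ 0 → arith γ) {α β d' : ℝ} (hβ : 0 ≤ β) (hαβ : β + d' < α)
    {C : ℝ} (ha : ∀ γ, ‖a γ‖ ≤ C * (1 + size γ) ^ (-α))
    {C' : ℝ} (hcount : ∀ R : ℝ, 0 ≤ R →
      ∃ s : Finset Orb, (∀ γ, arith γ → size γ ≤ R → γ ∈ s) ∧ (s.card : ℝ) ≤ C' * (1 + R) ^ β)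
    {Bb : ℝ} (hbb : ∀ γ, arith γ → ‖b γ‖ ≤ Bb * (1 + size γ) ^ d') :
    Summable fun γ => ‖a γ * b γ‖ := by
  classical
  set δ : ℝ := α - d' with hδ
  have hδβ : β < δ := by rw [hδ]; linarith
  set r : ℝ := (2 : ℝ) ^ (β - δ) with hr
  have hr0 : 0 ≤ r := by positivity
  have hr1 : r < 1 := Real.rpow_lt_one_of_one_lt_of_neg (by norm_num) (by linarith)
  set K : ℝ := max C' 0 * (2 : ℝ) ^ (2 * β) * (max C 0 * max Bb 0) with hK
  have hK0 : 0 ≤ K := by positivity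
  refine summable_of_sum_le (fun γ => norm_nonneg _) (c := K * (1 - r)⁻¹) fun s => ?_
  -- restrict to the support `arith`
  set s₀ : Finset Orb := s.filter arith with hs₀
  have h1 : ∑ γ ∈ s, ‖a γ * b γ‖ = ∑ γ ∈ s₀, ‖a γ * b γ‖ := by
    rw [hs₀, Finset.sum_filter]
    refine Finset.sum_congr rfl fun γ _ => ?_
    by_cases h : arith γ
    · simp only [h, if_true]
    · have hb0 : b γ = 0 := by
        by_contra hne
        exact h (hb γ hne)
      simp only [h, if_false, hb0, mul_zero, norm_zero]
  rw [h1]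
  -- the dyadic index
  set g : Orb → ℕ := fun γ => Nat.log 2 ⌊1 + size γ⌋₊ with hg
  set t : Finset ℕ := s₀.image g with ht
  rw [← Finset.sum_fiberwise_of_maps_to (g := g) (t := t) (fun γ hγ => Finset.mem_image_of_mem g hγ)]
  -- one dyadic slice
  have hfib : ∀ k ∈ t, ∑ γ ∈ s₀ with g γ = k, ‖a γ * b γ‖ ≤ K * r ^ k := by
    intro k _
    have h2k : (0 : ℝ) < 2 ^ k := by positivity
    -- each term of the slice
    have hterm : ∀ γ ∈ s₀.filter (fun γ => g γ = k),
        ‖a γ * b γ‖ ≤ max C 0 * max Bb 0 * (2 : ℝ) ^ (-δ * k) := by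
      intro γ hγ
      rw [Finset.mem_filter] at hγ
      obtain ⟨hγs₀, hγk⟩ := hγ
      have harith : arith γ := (Finset.mem_filter.mp hγs₀).2
      set u : ℝ := 1 + size γ with hu
      have hu1 : 1 ≤ u := by have := hsize γ; linarith
      have hu0 : 0 < u := by linarith
      have hk_le : (2 : ℝ) ^ k ≤ u := by
        rw [← hγk]
        exact two_pow_log_floor_le hu1
      have hA : ‖a γ‖ ≤ max C 0 * u ^ (-α) :=
        (ha γ).trans (mul_le_mul_of_nonneg_right (le_max_left C 0) (by positivity))
      have hB : ‖b γ‖ ≤ max Bb 0 * u ^ d' :=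
        (hbb γ harith).trans (mul_le_mul_of_nonneg_right (le_max_left Bb 0) (by positivity))
      have hpow : u ^ (-α) * u ^ d' = u ^ (-δ) := by
        rw [← Real.rpow_add hu0, hδ]
        ring_nf
      have hu_le : u ^ (-δ) ≤ (2 : ℝ) ^ (-δ * k) := by
        have h := Real.rpow_le_rpow_of_nonpos h2k hk_le (by linarith : -δ ≤ 0)
        have h' : ((2 : ℝ) ^ k) ^ (-δ) = (2 : ℝ) ^ (-δ * k) := by
          rw [← Real.rpow_natCast, ← Real.rpow_mul (by norm_num), mul_comm]
        rw [← h']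
        exact h
      calc ‖a γ * b γ‖ = ‖a γ‖ * ‖b γ‖ := norm_mul _ _
        _ ≤ (max C 0 * u ^ (-α)) * (max Bb 0 * u ^ d') :=
            mul_le_mul hA hB (norm_nonneg _) (by positivity)
        _ = max C 0 * max Bb 0 * (u ^ (-α) * u ^ d') := by ring
        _ = max C 0 * max Bb 0 * u ^ (-δ) := by rw [hpow]
        _ ≤ max C 0 * max Bb 0 * (2 : ℝ) ^ (-δ * k) :=
            mul_le_mul_of_nonneg_left hu_le (by positivity)
    -- the slice is small: it lies in the count-set at radius `2^{k+1}`
    obtain ⟨sk, hsk_mem, hsk_card⟩ := hcount ((2 : ℝ) ^ (k + 1)) (by positivity)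
    have hsub : s₀.filter (fun γ => g γ = k) ⊆ sk := by
      intro γ hγ
      rw [Finset.mem_filter] at hγ
      obtain ⟨hγs₀, hγk⟩ := hγ
      have harith : arith γ := (Finset.mem_filter.mp hγs₀).2
      have hle : 1 + size γ ≤ (2 : ℝ) ^ (k + 1) := by
        rw [← hγk]
        exact le_two_pow_log_floor_succ _
      exact hsk_mem γ harith (by linarith)
    have hcard : ((s₀.filter (fun γ => g γ = k)).card : ℝ) ≤
        max C' 0 * (2 : ℝ) ^ (2 * β) * (2 : ℝ) ^ (β * k) := by
      have hA : ((s₀.filter (fun γ => g γ = k)).card : ℝ) ≤ (sk.card : ℝ) := by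
        exact_mod_cast Finset.card_le_card hsub
      have hB : (1 : ℝ) + 2 ^ (k + 1) ≤ 2 ^ (k + 2) := by
        have : (1 : ℝ) ≤ 2 ^ (k + 1) := one_le_pow₀ (by norm_num)
        rw [pow_succ 2 (k + 1)]
        linarith
      have hC : ((1 : ℝ) + 2 ^ (k + 1)) ^ β ≤ ((2 : ℝ) ^ (k + 2)) ^ β :=
        Real.rpow_le_rpow (by positivity) hB hβ
      have hD : ((2 : ℝ) ^ (k + 2)) ^ β = (2 : ℝ) ^ (2 * β) * (2 : ℝ) ^ (β * k) := by
        rw [← Real.rpow_natCast, ← Real.rpow_mul (by norm_num), ← Real.rpow_add (by norm_num)]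
        congr 1
        push_cast
        ring
      calc ((s₀.filter (fun γ => g γ = k)).card : ℝ) ≤ (sk.card : ℝ) := hA
        _ ≤ C' * ((1 : ℝ) + 2 ^ (k + 1)) ^ β := hsk_card
        _ ≤ max C' 0 * ((2 : ℝ) ^ (k + 2)) ^ β :=
            mul_le_mul (le_max_left C' 0) hC (by positivity) (by positivity)
        _ = max C' 0 * (2 : ℝ) ^ (2 * β) * (2 : ℝ) ^ (β * k) := by rw [hD, mul_assoc]
    have hgeom : (2 : ℝ) ^ (β * k) * (2 : ℝ) ^ (-δ * k) = r ^ k := by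
      rw [← Real.rpow_add (by norm_num), hr, ← Real.rpow_natCast, ← Real.rpow_mul (by norm_num)]
      congr 1
      ring
    calc ∑ γ ∈ s₀ with g γ = k, ‖a γ * b γ‖
        ≤ ∑ γ ∈ s₀ with g γ = k, max C 0 * max Bb 0 * (2 : ℝ) ^ (-δ * k) := Finset.sum_le_sum hterm
      _ = ((s₀.filter (fun γ => g γ = k)).card : ℝ) * (max C 0 * max Bb 0 * (2 : ℝ) ^ (-δ * k)) := by
          rw [Finset.sum_const, nsmul_eq_mul]
      _ ≤ (max C' 0 * (2 : ℝ) ^ (2 * β) * (2 : ℝ) ^ (β * k)) *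
            (max C 0 * max Bb 0 * (2 : ℝ) ^ (-δ * k)) :=
          mul_le_mul_of_nonneg_right hcard (by positivity)
      _ = K * ((2 : ℝ) ^ (β * k) * (2 : ℝ) ^ (-δ * k)) := by rw [hK]; ring
      _ = K * r ^ k := by rw [hgeom]
  have hsum : Summable fun k : ℕ => K * r ^ k := (summable_geometric_of_lt_one hr0 hr1).mul_left K
  calc ∑ k ∈ t, ∑ γ ∈ s₀ with g γ = k, ‖a γ * b γ‖ ≤ ∑ k ∈ t, K * r ^ k := Finset.sum_le_sum hfib
    _ ≤ ∑' k : ℕ, K * r ^ k := hsum.sum_le_tsum t (fun k _ => by positivity)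
    _ = K * (1 - r)⁻¹ := by rw [tsum_mul_left, tsum_geometric_of_lt_one hr0 hr1]

/-- the same with the finite factor bounded RELATIVE to a distinguished `γ₀` (the shape of `DominantSide.b_bound`):
`‖b γ‖ ≤ B (1 + size γ)^{d'} ‖b γ₀‖` on the support -/
theorem summable_of_count_decay_rel {Orb : Type} (a b : Orb → ℂ) (size : Orb → ℝ) (hsize : ∀ γ, 0 ≤ size γ)
    (arith : Orb → Prop) (hb : ∀ γ, b γ ≠ 0 → arith γ) {α β d' : ℝ} (hβ : 0 ≤ β) (hαβ : β + d' < α)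
    {C : ℝ} (ha : ∀ γ, ‖a γ‖ ≤ C * (1 + size γ) ^ (-α))
    {C' : ℝ} (hcount : ∀ R : ℝ, 0 ≤ R →
      ∃ s : Finset Orb, (∀ γ, arith γ → size γ ≤ R → γ ∈ s) ∧ (s.card : ℝ) ≤ C' * (1 + R) ^ β)
    (γ₀ : Orb) {Bb : ℝ} (hbb : ∀ γ, arith γ → ‖b γ‖ ≤ Bb * (1 + size γ) ^ d' * ‖b γ₀‖) :
    Summable fun γ => ‖a γ * b γ‖ :=
  summable_of_count_decay a b size hsize arith hb hβ hαβ ha hcount (Bb := Bb * ‖b γ₀‖)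
    fun γ hγ => by
      have := hbb γ hγ
      linarith [show Bb * (1 + size γ) ^ d' * ‖b γ₀‖ = Bb * ‖b γ₀‖ * (1 + size γ) ^ d' by ring]

/-- **`abs_summable` IS DERIVED**: in the vocabulary of p1's `DominantSide` (row 674) — `orb N γ = a γ * b N γ`, `a_bound`,
`b_support`, `count_bound` (uniform in the level), `b_bound` relative to `γ₀`, `β + d' < α` — the geometric side converges
absolutely at every level. -/
theorem abs_summable_of_fields {Orb : Type} (a : Orb → ℂ) (b : ℕ → Orb → ℂ) (orb : ℕ → Orb → ℂ)
    (orb_eq : ∀ N γ, orb N γ = a γ * b N γ) (size : Orb → ℝ) (size_nonneg : ∀ γ, 0 ≤ size γ)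
    (arith : ℕ → Orb → Prop) (b_support : ∀ N γ, b N γ ≠ 0 → arith N γ) {α β d' : ℝ} (hβ : 0 ≤ β)
    (hαβ : β + d' < α) (a_bound : ∃ C : ℝ, ∀ γ, ‖a γ‖ ≤ C * (1 + size γ) ^ (-α)) (γ₀ : Orb)
    (count_bound : ∃ C' : ℝ, ∀ N (R : ℝ), 0 ≤ R →
      ∃ s : Finset Orb, (∀ γ, arith N γ → size γ ≤ R → γ ∈ s) ∧ (s.card : ℝ) ≤ C' * (1 + R) ^ β)
    (b_bound : ∃ B : ℝ, ∀ N γ, arith N γ → ‖b N γ‖ ≤ B * (1 + size γ) ^ d' * ‖b N γ₀‖) :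
    ∀ N, Summable fun γ => ‖orb N γ‖ := by
  intro N
  obtain ⟨C, ha⟩ := a_bound
  obtain ⟨C', hcount⟩ := count_bound
  obtain ⟨Bb, hbb⟩ := b_bound
  have h : Summable fun γ => ‖a γ * b N γ‖ :=
    summable_of_count_decay_rel a (b N) size size_nonneg (arith N) (b_support N) hβ hαβ ha
      (hcount N) γ₀ (hbb N)
  refine h.congr fun γ => ?_
  rw [orb_eq]

end Summit.Ventures.HodgeRepro2.Tier7.Line3.AbsSummable
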